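import Summits.CriticalPhenomena.PercolationContinuityZ3.Theorems.PercNearOneGluingNoHeavyLowerTailSahiCTCLadderShapesA
import HarnessLib

/-!
# `NoHeavyLowerTail` (crux stmt-CriticalPhenomena-4575), P3 lane: the ladder form coefficient by coefficient — shapes II (memo g25 §3 (iii), (iv))

Support file (seat `prim-l12-p3`, gen 25; `--supports stmt-CriticalPhenomena-4575`).  Continues `…SahiCTCLadderShapesA`: the profiles with no tripled point
and three (`shape_three`, via `row_three`) or two (`shape_two`, via `row_two`) doubled points.  Nothing is asserted about the crux.
-/

namespace Summit.CriticalPhenomena.PercolationContinuityZ3.Theorems.SahiCTCForms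

open Finset MvPolynomial SahiCTCGenFun

variable {α : Type*} [DecidableEq α] [Fintype α]

section Shapes2
variable {𝒳 𝒵 : Finset (Finset α)} {m : α →₀ ℕ}

/-- **Shape (iii)**: three doubled points, no tripled point. [this work] -/
theorem shape_three (h𝒳 : IsUpperSet (𝒳 : Set (Finset α))) (h𝒵 : IsUpperSet (𝒵 : Set (Finset α)))
    (hX2 : ∀ U ∈ 𝒳, 2 ≤ #U) (hZ2 : ∀ U ∈ 𝒵, 2 ≤ #U) (h3 : ∀ i, m i ≤ 3) (hM : lev m 3 = ∅) (hD : #(lev m 2) = 3) :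
    ∑ e ∈ cedges 𝒳 𝒵 m.support, ((Th1 : MvPolynomial α ℤ) * gf (bySize (2 ≤ ·) : Finset (Finset α))).coeff (m - ind e)
      ≤ (ee 2 * (PiP * gf (𝒳 ∩ 𝒵) - gf 𝒳 * gf 𝒵)).coeff m := by
  set D := lev m 2 with hDdef
  set T := lev m 1 with hT
  have hDT : Disjoint D T := disjoint_lev (by norm_num) (by norm_num) (by norm_num)
  have hsupp : m.support = D ∪ T := by rw [support_eq_lev_union h3, hM, empty_union]
  have hMe : ∀ e : Finset α, lev m 3 ⊆ e := fun e => by rw [hM]; exact empty_subset e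
  -- charge side: only the common edges inside D count, each at most once
  have hB : ∑ e ∈ cedges 𝒳 𝒵 m.support, ((Th1 : MvPolynomial α ℤ) * gf (bySize (2 ≤ ·) : Finset (Finset α))).coeff (m - ind e)
      ≤ #(cedges 𝒳 𝒵 D) := by
    have hterm : ∀ e ∈ cedges 𝒳 𝒵 m.support,
        ((Th1 : MvPolynomial α ℤ) * gf (bySize (2 ≤ ·) : Finset (Finset α))).coeff (m - ind e) ≤ if e ⊆ D then 1 else 0 :=
      fun e he => by
      obtain ⟨_, he2, -, -⟩ := mem_cedges.1 he
      split_ifs with heD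
      · refine (charge_le_one h3 (e := e) (hMe _) ?_).trans (by split_ifs <;> norm_num)
        rw [hM, empty_inter, empty_union, ← hDdef, card_sdiff_of_subset heD, hD, he2]
      · refine le_of_eq (charge_eq_zero_of_two_le h3 (e := e) (hMe _) ?_)
        rw [hM, empty_inter, empty_union, ← hDdef]
        have : #(D ∩ e) ≤ 1 := by
          by_contra hlt
          have h2 : 2 ≤ #(D ∩ e) := by omega
          have : D ∩ e = e := eq_of_subset_of_card_le inter_subset_right (by rw [he2]; exact h2)
          exact heD (this ▸ inter_subset_left)
        have := card_sdiff_add_card_inter D e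
        omega
    refine (sum_le_sum hterm).trans ?_
    rw [← Finset.sum_filter, sum_const, nsmul_eq_mul, mul_one]
    have : (cedges 𝒳 𝒵 m.support).filter (fun e => e ⊆ D) = cedges 𝒳 𝒵 D := by
      ext e; simp only [mem_filter, mem_cedges, hsupp]
      constructor
      · rintro ⟨⟨_, h2, h3, h4⟩, h1⟩; exact ⟨h1, h2, h3, h4⟩
      · rintro ⟨h1, h2, h3, h4⟩; exact ⟨⟨h1.trans subset_union_left, h2, h3, h4⟩, h1⟩
    rw [this]
  -- surplus side
  have hA := row_three h𝒳 h𝒵 hX2 hZ2 hD hDT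
  have hadm : D.image (fun x => D.erase x) ⊆ (bySize (· = 2) : Finset (Finset α)).filter fun E => ind E ≤ m := fun E hE => by
    obtain ⟨x, hx, rfl⟩ := mem_image.1 hE
    refine mem_filter.2 ⟨?_, (SahiAllButC.ind_le_iff_subset_support _ _).2 ((erase_subset x D).trans (by rw [hsupp]; exact subset_union_left))⟩
    unfold bySize; exact mem_filter.2 ⟨mem_powerset.2 (subset_univ _), by rw [card_erase_of_mem hx, hD]⟩
  have hS := sum_le_coeff_ee_two_mul_harris h𝒳 h𝒵 m hadm
  rw [sum_image (erase_injOn D)] at hS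
  have heq : ∀ x ∈ D, (PiP * gf (𝒳 ∩ 𝒵) - gf 𝒳 * gf 𝒵).coeff (m - ind (D.erase x)) = kap 𝒳 𝒵 {x} (D.erase x ∪ T) := fun x hx => by
    rw [coeff_harris_residual h3 (hMe _), hM, empty_inter, empty_union, ← hDdef, sdiff_erase_self hx,
      inter_eq_right.2 (erase_subset x D)]
    congr 1
    rw [← hT]
    congr 1
    exact sdiff_eq_self_of_disjoint (Disjoint.mono_left (erase_subset x D) hDT).symm
  rw [sum_congr rfl heq] at hS
  linarith

/-- **Shape (iv)**: two doubled points, no tripled point. [this work] -/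
theorem shape_two (h𝒳 : IsUpperSet (𝒳 : Set (Finset α))) (h𝒵 : IsUpperSet (𝒵 : Set (Finset α)))
    (hX2 : ∀ U ∈ 𝒳, 2 ≤ #U) (hZ2 : ∀ U ∈ 𝒵, 2 ≤ #U) (h3 : ∀ i, m i ≤ 3) (hM : lev m 3 = ∅) {a b : α} (hab : a ≠ b)
    (hD : lev m 2 = {a, b}) :
    ∑ e ∈ cedges 𝒳 𝒵 m.support, ((Th1 : MvPolynomial α ℤ) * gf (bySize (2 ≤ ·) : Finset (Finset α))).coeff (m - ind e)
      ≤ (ee 2 * (PiP * gf (𝒳 ∩ 𝒵) - gf 𝒳 * gf 𝒵)).coeff m := by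
  set T := lev m 1 with hT
  have hDT : Disjoint ({a, b} : Finset α) T := by
    have := disjoint_lev (m := m) (k := 2) (k' := 1) (by norm_num) (by norm_num) (by norm_num)
    rw [hD] at this; exact this
  have haT : a ∉ T := fun h => (Finset.disjoint_left.1 hDT) (by simp) h
  have hbT : b ∉ T := fun h => (Finset.disjoint_left.1 hDT) (by simp) h
  have habT : a ∉ insert b T := by rw [mem_insert, not_or]; exact ⟨hab, haT⟩
  have hsupp : m.support = insert a (insert b T) := by
    rw [support_eq_lev_union h3, hM, hD, empty_union, ← hT, insert_union, ← insert_eq]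
  have hMe : ∀ e : Finset α, lev m 3 ⊆ e := fun e => by rw [hM]; exact empty_subset e
  rw [hsupp, sum_cedges_insert habT, sum_cedges_insert hbT]
  -- the common neighbours of a in ab ∪ T
  have hcn : cnbrs 𝒳 𝒵 (insert a (insert b T)) a =
      (if ({a, b} : Finset α) ∈ 𝒳 ∧ ({a, b} : Finset α) ∈ 𝒵 then insert b (cnbrs 𝒳 𝒵 (insert a T) a) else cnbrs 𝒳 𝒵 (insert a T) a) := by
    unfold cnbrs; rw [erase_insert habT, erase_insert haT, filter_insert]
  have hbN : b ∉ cnbrs 𝒳 𝒵 (insert a T) a := fun h => hbT ((mem_cnbrs_insert haT).1 h).1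
  -- charge bounds
  have gab : ((Th1 : MvPolynomial α ℤ) * gf (bySize (2 ≤ ·) : Finset (Finset α))).coeff (m - ind {a, b})
      ≤ 1 + (if 1 ≤ #T then (#T : ℤ) + 2 else 0) := by
    have h := charge_le_sqfree h3 (e := ({a, b} : Finset α)) (hMe _) (by rw [hM, hD, empty_inter, empty_union, Finset.sdiff_self, card_empty])
    have hc : #((lev m 2 ∩ {a, b}) ∪ (lev m 1 \ {a, b})) = #T + 2 := by
      rw [hD, inter_self, ← hT, sdiff_eq_self_of_disjoint hDT.symm, card_union_of_disjoint hDT, card_pair hab, add_comm]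
    rw [hc] at h
    refine h.trans ?_
    by_cases h1 : 1 ≤ #T
    · rw [if_pos (by omega), if_pos (by omega), if_pos h1]; push_cast; linarith
    · rw [if_pos (by omega), if_neg (by omega), if_neg h1]
  have gay : ∀ y ∈ cnbrs 𝒳 𝒵 (insert a T) a, ((Th1 : MvPolynomial α ℤ) * gf (bySize (2 ≤ ·) : Finset (Finset α))).coeff (m - ind {a, y})
      ≤ (if 1 ≤ #T then 1 else 0) := fun y hy => by
    have hyT := ((mem_cnbrs_insert haT).1 hy).1
    have hby : b ≠ y := fun h => hbT (h ▸ hyT)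
    have hay : a ≠ y := fun h => haT (h ▸ hyT)
    have e1 : ({a, b} : Finset α) \ {a, y} = {b} := by
      ext x; simp only [mem_sdiff, mem_insert, mem_singleton]
      constructor
      · rintro ⟨h1 | h1, h2⟩
        · exact absurd (Or.inl h1) h2
        · exact h1
      · rintro rfl; exact ⟨Or.inr rfl, fun h => h.elim (fun h => hab h.symm) fun h => hby h⟩
    have e2 : ({a, b} : Finset α) ∩ {a, y} = {a} := by
      ext x; simp only [mem_inter, mem_insert, mem_singleton]
      constructor
      · rintro ⟨h1 | h1, h2 | h2⟩
        · exact h1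
        · exact h1
        · exact h2
        · exact absurd (h1.symm.trans h2) hby
      · rintro rfl; exact ⟨Or.inl rfl, Or.inl rfl⟩
    have e3 : T \ {a, y} = T.erase y := by
      ext x; simp only [mem_sdiff, mem_insert, mem_singleton, mem_erase, not_or]
      exact ⟨fun ⟨h1, _, h3⟩ => ⟨h3, h1⟩, fun ⟨h1, h2⟩ => ⟨h2, fun h => haT (h ▸ h2), h1⟩⟩
    have h := charge_le_one h3 (e := ({a, y} : Finset α)) (hMe _) (by rw [hM, hD, empty_inter, empty_union, e1, card_singleton])
    have hc : #((lev m 2 ∩ {a, y}) ∪ (lev m 1 \ {a, y})) = #T := by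
      rw [hD, ← hT, e2, e3, card_union_of_disjoint (by rw [disjoint_singleton_left]; exact fun h => haT (mem_of_mem_erase h)),
        card_singleton, card_erase_of_mem hyT]
      have := card_pos.2 ⟨y, hyT⟩; omega
    rw [hc] at h; exact h
  have gby : ∀ y ∈ cnbrs 𝒳 𝒵 (insert b T) b, ((Th1 : MvPolynomial α ℤ) * gf (bySize (2 ≤ ·) : Finset (Finset α))).coeff (m - ind {b, y})
      ≤ (if 1 ≤ #T then 1 else 0) := fun y hy => by
    have hyT := ((mem_cnbrs_insert hbT).1 hy).1
    have hby : b ≠ y := fun h => hbT (h ▸ hyT)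
    have hay : a ≠ y := fun h => haT (h ▸ hyT)
    have e1 : ({a, b} : Finset α) \ {b, y} = {a} := by
      ext x; simp only [mem_sdiff, mem_insert, mem_singleton]
      constructor
      · rintro ⟨h1 | h1, h2⟩
        · exact h1
        · exact absurd (Or.inl h1) h2
      · rintro rfl; exact ⟨Or.inl rfl, fun h => h.elim (fun h => hab h) fun h => hay h⟩
    have e2 : ({a, b} : Finset α) ∩ {b, y} = {b} := by
      ext x; simp only [mem_inter, mem_insert, mem_singleton]
      constructor
      · rintro ⟨h1 | h1, h2 | h2⟩
        · exact h2
        · exact absurd (h1.symm.trans h2) hay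
        · exact h1
        · exact h1
      · rintro rfl; exact ⟨Or.inr rfl, Or.inl rfl⟩
    have e3 : T \ {b, y} = T.erase y := by
      ext x; simp only [mem_sdiff, mem_insert, mem_singleton, mem_erase, not_or]
      exact ⟨fun ⟨h1, _, h3⟩ => ⟨h3, h1⟩, fun ⟨h1, h2⟩ => ⟨h2, fun h => hbT (h ▸ h2), h1⟩⟩
    have h := charge_le_one h3 (e := ({b, y} : Finset α)) (hMe _) (by rw [hM, hD, empty_inter, empty_union, e1, card_singleton])
    have hc : #((lev m 2 ∩ {b, y}) ∪ (lev m 1 \ {b, y})) = #T := by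
      rw [hD, ← hT, e2, e3, card_union_of_disjoint (by rw [disjoint_singleton_left]; exact fun h => hbT (mem_of_mem_erase h)),
        card_singleton, card_erase_of_mem hyT]
      have := card_pos.2 ⟨y, hyT⟩; omega
    rw [hc] at h; exact h
  have gT : ∀ e ∈ cedges 𝒳 𝒵 T, ((Th1 : MvPolynomial α ℤ) * gf (bySize (2 ≤ ·) : Finset (Finset α))).coeff (m - ind e) = 0 :=
    fun e he => by
    obtain ⟨heT, _, -, -⟩ := mem_cedges.1 he
    refine charge_eq_zero_of_two_le h3 (e := e) (hMe _) ?_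
    rw [hM, hD, empty_inter, empty_union, sdiff_eq_self_of_disjoint (Disjoint.mono_right heT hDT), card_pair hab]
  -- surplus side
  have hA := row_two h𝒳 h𝒵 hX2 hZ2 hab haT hbT
  have hadm1 : ({({a, b} : Finset α)} : Finset (Finset α)) ⊆ (bySize (· = 2) : Finset (Finset α)).filter fun E => ind E ≤ m :=
    singleton_subset_iff.2 (pair_mem_admissible hab (by rw [hsupp]; simp) (by rw [hsupp]; simp))
  have hadma : T.image (fun y => ({a, y} : Finset α)) ⊆ (bySize (· = 2) : Finset (Finset α)).filter fun E => ind E ≤ m :=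
    fun E hE => by
      obtain ⟨y, hy, rfl⟩ := mem_image.1 hE
      exact pair_mem_admissible (fun h => haT (h ▸ hy)) (by rw [hsupp]; simp) (by rw [hsupp]; simp [hy])
  have hadmb : T.image (fun y => ({b, y} : Finset α)) ⊆ (bySize (· = 2) : Finset (Finset α)).filter fun E => ind E ≤ m :=
    fun E hE => by
      obtain ⟨y, hy, rfl⟩ := mem_image.1 hE
      exact pair_mem_admissible (fun h => hbT (h ▸ hy)) (by rw [hsupp]; simp) (by rw [hsupp]; simp [hy])
  have hd1 : Disjoint ({({a, b} : Finset α)} : Finset (Finset α)) (T.image fun y => ({a, y} : Finset α)) := by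
    rw [disjoint_singleton_left]; intro h
    obtain ⟨y, hy, hy'⟩ := mem_image.1 h
    have : b ∈ ({a, y} : Finset α) := by rw [hy']; simp
    simp only [mem_insert, mem_singleton] at this
    rcases this with h1 | h1; exact hab h1.symm; exact hbT (h1 ▸ hy)
  have hd2 : Disjoint ({({a, b} : Finset α)} ∪ T.image (fun y => ({a, y} : Finset α))) (T.image fun y => ({b, y} : Finset α)) := by
    rw [Finset.disjoint_left]; intro E hE hE'
    obtain ⟨y, hy, rfl⟩ := mem_image.1 hE'
    have hay : a ≠ y := fun h => haT (h ▸ hy)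
    have haE : a ∉ ({b, y} : Finset α) := by simp [hab, hay]
    rcases mem_union.1 hE with h | h
    · rw [mem_singleton] at h; exact haE (by rw [h]; simp)
    · obtain ⟨y', _, h'⟩ := mem_image.1 h; exact haE (by rw [← h']; simp)
  have hS := sum_le_coeff_ee_two_mul_harris h𝒳 h𝒵 m (union_subset (union_subset hadm1 hadma) hadmb)
  rw [sum_union hd2, sum_union hd1, sum_singleton, sum_image (injOn_pair a haT), sum_image (injOn_pair b hbT)] at hS
  have e0 : (PiP * gf (𝒳 ∩ 𝒵) - gf 𝒳 * gf 𝒵).coeff (m - ind {a, b}) = kap 𝒳 𝒵 ∅ (insert a (insert b T)) := by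
    rw [coeff_harris_residual h3 (hMe _), hM, hD, empty_inter, empty_union, Finset.sdiff_self, inter_self, ← hT,
      sdiff_eq_self_of_disjoint hDT.symm, insert_union, ← insert_eq]
  have ea : ∀ y ∈ T, (PiP * gf (𝒳 ∩ 𝒵) - gf 𝒳 * gf 𝒵).coeff (m - ind {a, y}) = kap 𝒳 𝒵 {b} (insert a (T.erase y)) :=
    fun y hy => by
    have hby : b ≠ y := fun h => hbT (h ▸ hy)
    rw [coeff_harris_residual h3 (hMe _), hM, hD, empty_inter, empty_union, ← hT]
    congr 1
    · ext x; simp only [mem_sdiff, mem_insert, mem_singleton]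
      constructor
      · rintro ⟨h1 | h1, h2⟩; exact absurd (Or.inl h1) h2; exact h1
      · rintro rfl; exact ⟨Or.inr rfl, fun h => h.elim (fun h => hab h.symm) fun h => hby h⟩
    · ext x; simp only [mem_union, mem_inter, mem_insert, mem_singleton, mem_sdiff, mem_erase]
      constructor
      · rintro (⟨h1 | h1, h2⟩ | ⟨h1, h2⟩)
        · exact Or.inl h1
        · subst h1; rcases h2 with h2 | h2; exact absurd h2.symm hab; exact absurd (h2 ▸ hy) hbT
        · push Not at h2; exact Or.inr ⟨h2.2, h1⟩
      · rintro (rfl | ⟨h1, h2⟩)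
        · exact Or.inl ⟨Or.inl rfl, Or.inl rfl⟩
        · exact Or.inr ⟨h2, fun h => h.elim (fun h => haT (h ▸ h2)) fun h => h1 h⟩
  have eb : ∀ y ∈ T, (PiP * gf (𝒳 ∩ 𝒵) - gf 𝒳 * gf 𝒵).coeff (m - ind {b, y}) = kap 𝒳 𝒵 {a} (insert b (T.erase y)) :=
    fun y hy => by
    have hay : a ≠ y := fun h => haT (h ▸ hy)
    rw [coeff_harris_residual h3 (hMe _), hM, hD, empty_inter, empty_union, ← hT]
    congr 1
    · ext x; simp only [mem_sdiff, mem_insert, mem_singleton]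
      constructor
      · rintro ⟨h1 | h1, h2⟩; exact h1; exact absurd (Or.inl h1) h2
      · rintro rfl; exact ⟨Or.inl rfl, fun h => h.elim (fun h => hab h) fun h => hay h⟩
    · ext x; simp only [mem_union, mem_inter, mem_insert, mem_singleton, mem_sdiff, mem_erase]
      constructor
      · rintro (⟨h1 | h1, h2⟩ | ⟨h1, h2⟩)
        · subst h1; rcases h2 with h2 | h2; exact absurd h2 hab; exact absurd (h2 ▸ hy) haT
        · exact Or.inl h1
        · push Not at h2; exact Or.inr ⟨h2.2, h1⟩
      · rintro (rfl | ⟨h1, h2⟩)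
        · exact Or.inl ⟨Or.inr rfl, Or.inl rfl⟩
        · exact Or.inr ⟨h2, fun h => h.elim (fun h => hbT (h ▸ h2)) fun h => h1 h⟩
  rw [e0, sum_congr rfl ea, sum_congr rfl eb] at hS
  rw [sum_add_distrib] at hA
  -- charge total
  have hBa : ∑ y ∈ cnbrs 𝒳 𝒵 (insert a (insert b T)) a,
      ((Th1 : MvPolynomial α ℤ) * gf (bySize (2 ≤ ·) : Finset (Finset α))).coeff (m - ind {a, y})
      ≤ (if ({a, b} : Finset α) ∈ 𝒳 ∧ ({a, b} : Finset α) ∈ 𝒵 then (1 : ℤ) + (if 1 ≤ #T then (#T : ℤ) + 2 else 0) else 0)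
        + #(cnbrs 𝒳 𝒵 (insert a T) a) * (if 1 ≤ #T then (1 : ℤ) else 0) := by
    rw [hcn]
    have hs := sum_le_sum gay
    rw [sum_const, nsmul_eq_mul] at hs
    by_cases hcom : ({a, b} : Finset α) ∈ 𝒳 ∧ ({a, b} : Finset α) ∈ 𝒵
    · rw [if_pos hcom, if_pos hcom, sum_insert hbN]; linarith
    · rw [if_neg hcom, if_neg hcom]; linarith
  have hBb : ∑ y ∈ cnbrs 𝒳 𝒵 (insert b T) b,
      ((Th1 : MvPolynomial α ℤ) * gf (bySize (2 ≤ ·) : Finset (Finset α))).coeff (m - ind {b, y})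
      ≤ #(cnbrs 𝒳 𝒵 (insert b T) b) * (if 1 ≤ #T then (1 : ℤ) else 0) := by
    have := sum_le_sum gby; rw [sum_const, nsmul_eq_mul] at this; exact this
  have hBT : ∑ e ∈ cedges 𝒳 𝒵 T, ((Th1 : MvPolynomial α ℤ) * gf (bySize (2 ≤ ·) : Finset (Finset α))).coeff (m - ind e) = 0 := by
    rw [sum_congr rfl gT, sum_const_zero]
  rw [hBT, add_zero]
  have hNa0 : (0 : ℤ) ≤ #(cnbrs 𝒳 𝒵 (insert a T) a) := Nat.cast_nonneg _
  have hNb0 : (0 : ℤ) ≤ #(cnbrs 𝒳 𝒵 (insert b T) b) := Nat.cast_nonneg _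
  by_cases h1 : 1 ≤ #T
  · simp only [h1, if_true, mul_one] at hBa hBb hA; linarith
  · simp only [h1, if_false, mul_zero, add_zero] at hBa hBb hA; linarith

end Shapes2

end Summit.CriticalPhenomena.PercolationContinuityZ3.Theorems.SahiCTCForms
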